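import Summits.QuantumFields.YangMills.Theorems.AlphaInputsT3ACv4ChiInt
import HarnessLib

/-!
# `AlphaInputsT3ACAnnulusSplit` — THE B0-VALUE-FREE SKELETON OF (★3): the gap between the PLAIN small-field pin `χ` and the WEIGHTED pin `χ·𝟙[loPrintAC k]` of the
step-`k` fluctuation integral is `≤ log (1 + (Σ_{p′} a_{p′}) ∕ b)` (cell `ym3-torus`, (α)-row #23 ∕ (R7) docket of stmt-19936; seat px20 g14, door 6; ★★OWNER g38 №147 GO)

WHAT.  ★★ `AlphaInputsT3AC.PkgCoreRows.log_gap_le_of_annulus` (§4): for ANY measure `μ`, measurable field map `Ψ` into the level-`k` fields (`Ψ = Φ(V, ·)` in the B0 pin),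
weight `χ ≥ 0` and integrand `G ≥ 0` with `χ·G` integrable: `log ∫ χ·G ≤ log ∫ χ·𝟙[loPrintAC k](Ψ ·)·G + log (1 + (Σ_{p′} a_{p′}) ∕ b)` as soon as every ANNULUS-PLAQUETTE
piece is bounded, `∫ χ·𝟙[A_{k,p′}](Ψ ·)·G ≤ a_{p′}`, `A_{k,p′} := {U | θBal(K−k)∕max(B₃,1) ≤ |U(∂p′) − 1|}`, and the bulk is charged, `0 < b ≤ ∫ χ·𝟙[loPrintAC k](Ψ ·)·G`.
Pieces: §1 the LOG-SPLIT `log ∫ w₀·G ≤ log ∫ w₁·G + log (1 + A∕b)` (`w₁ ≤ w₀`, `∫ (w₀ − w₁)·G ≤ A`, `0 < b ≤ ∫ w₁·G`) and the free direction `log ∫ w₁·G ≤ log ∫ w₀·G`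
(the two pins are ORDERED); §2 the UNION BOUND `∫ w·𝟙[⋃ Sᵢ]·G ≤ Σᵢ ∫ w·𝟙[Sᵢ]·G` in weighted-integral currency (measure-currency twin: lit
✓`T3CruxEstimates.real_not_plaqSmall_comp_le_sum`); §3 (★2) IN PIN FORM `(loPrintAC k)ᶜ ⊆ ⋃_{p′} A_{k,p′}` from ✓`PkgCoreRows.intWindowT3_subset_loPrintAC` ([Balaban1985Variational]
Thm 1 (8) = row r1 at the free radius) and lit ✓`T3CruxEstimates.setOf_not_plaqSmall_eq` (cited BY NAME, not restated).

WHY.  The registered B0 pin puts the PLAIN `χB_k(triv′)` in the `logFl` slot; door 4 (✓`…v3StepLowWeightedPrint`) closes the lower row #23 at print's family with the WEIGHTED pin;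
whichever row text the post-freeze planner picks, the price is the SAME inequality (★) «`logFl[χB] − logFl[χB·𝟙[loPrintAC k]]` is large-field-small» (w8-19936 g17 LOCATE
76ccf7b5 §1).  This file discharges its bookkeeping and DISPLAYS the only B0-dependent quantities: the per-annulus-plaquette masses `a_{p′}` ((★1)-scaled ∘ action
localisation, [Balaban1985UV3] (67)–(71) p.273 «the corresponding part of the exponential gives the small factor exp(−¼p²(g_j))») and the bulk value `b` ((58)).

HONEST SCOPE.  [folklore] measure theory + one tree inclusion; def-free; `a_{p′}`, `b`, `ha₁` are HYPOTHESES; nothing of (★), of rows #22∕#23 as registered, of `hdom`, of (57)∕(O‴χₛ),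
of `HistoryTailL` (stmt-19936), EX, 19200, 20520 or `YM3TorusSU2` is proved here; rung R3 = SU(2) YM₃ on T³ — NOT d = 4, NOT infinite volume, NOT a mass gap, NOT Clay.
-/

set_option autoImplicit false

noncomputable section

open scoped ENNReal NNReal
open Set MeasureTheory

/-! ## §1 The log-split (pure measure theory) -/

namespace Summit.QuantumFields.YangMills.Theorems.AnnulusSplit

variable {α : Type*} [MeasurableSpace α] (μ : Measure α)

/-- **THE FREE DIRECTION** `log ∫ w₁·G ≤ log ∫ w₀·G` (`w₁ ≤ w₀`, `G ≥ 0`, the smaller integral positive): the two pins are ORDERED. [folklore] -/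
theorem log_integral_weight_mono {w₀ w₁ G : α → ℝ} (hG : ∀ x, 0 ≤ G x) (hw : ∀ x, w₁ x ≤ w₀ x)
    (hint₀ : Integrable (fun x => w₀ x * G x) μ) (hint₁ : Integrable (fun x => w₁ x * G x) μ) (hpos : 0 < ∫ x, w₁ x * G x ∂μ) :
    Real.log (∫ x, w₁ x * G x ∂μ) ≤ Real.log (∫ x, w₀ x * G x ∂μ) :=
  Real.log_le_log hpos (integral_mono hint₁ hint₀ fun x => mul_le_mul_of_nonneg_right (hw x) (hG x))

/-- ★ **THE LOG-SPLIT**: `w₁ ≤ w₀`, `G ≥ 0`, `∫ (w₀ − w₁)·G ≤ A`, `0 < b ≤ ∫ w₁·G` ⟹ `log ∫ w₀·G ≤ log ∫ w₁·G + log (1 + A∕b)` (the shape of (★) at `w₀ = χB`, `w₁ = χB·𝟙[loPrintAC k]`). [folklore] -/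
theorem log_integral_le_log_integral_add_log {w₀ w₁ G : α → ℝ} {A b : ℝ} (hG : ∀ x, 0 ≤ G x) (hw : ∀ x, w₁ x ≤ w₀ x)
    (hint₀ : Integrable (fun x => w₀ x * G x) μ) (hint₁ : Integrable (fun x => w₁ x * G x) μ)
    (hA : ∫ x, (w₀ x - w₁ x) * G x ∂μ ≤ A) (hb : 0 < b) (hb₁ : b ≤ ∫ x, w₁ x * G x ∂μ) :
    Real.log (∫ x, w₀ x * G x ∂μ) ≤ Real.log (∫ x, w₁ x * G x ∂μ) + Real.log (1 + A / b) := by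
  have hD : ∫ x, (w₀ x - w₁ x) * G x ∂μ = (∫ x, w₀ x * G x ∂μ) - ∫ x, w₁ x * G x ∂μ := by
    simp_rw [sub_mul]; exact integral_sub hint₀ hint₁
  have hA0 : 0 ≤ A := (integral_nonneg fun x => mul_nonneg (sub_nonneg.mpr (hw x)) (hG x)).trans hA
  have hI₁ : 0 < ∫ x, w₁ x * G x ∂μ := hb.trans_le hb₁
  have hI₀ : 0 < ∫ x, w₀ x * G x ∂μ := hI₁.trans_le (integral_mono hint₁ hint₀ fun x => mul_le_mul_of_nonneg_right (hw x) (hG x))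
  have hAb : 0 ≤ A / b := div_nonneg hA0 hb.le
  have hkey : (∫ x, w₁ x * G x ∂μ) * (1 + A / b) = (∫ x, w₁ x * G x ∂μ) + A + ((∫ x, w₁ x * G x ∂μ) - b) * (A / b) := by
    field_simp; ring
  have hle : ∫ x, w₀ x * G x ∂μ ≤ (∫ x, w₁ x * G x ∂μ) * (1 + A / b) := by
    rw [hkey]; nlinarith [mul_nonneg (sub_nonneg.mpr hb₁) hAb]
  calc Real.log (∫ x, w₀ x * G x ∂μ) ≤ Real.log ((∫ x, w₁ x * G x ∂μ) * (1 + A / b)) := Real.log_le_log hI₀ hle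
    _ = Real.log (∫ x, w₁ x * G x ∂μ) + Real.log (1 + A / b) := Real.log_mul hI₁.ne' (by linarith : 0 < 1 + A / b).ne'

/-! ## §2 The union bound over a finite family of sets -/

variable {ι : Type*} [Fintype ι]

omit [MeasurableSpace α] in
/-- The indicator of a finite union is at most the sum of the indicators. [folklore] -/
theorem indicator_iUnion_one_le_sum (S : ι → Set α) (x : α) :
    (⋃ i, S i).indicator (fun _ => (1 : ℝ)) x ≤ ∑ i, (S i).indicator (fun _ => (1 : ℝ)) x := by
  classical
  by_cases hx : x ∈ ⋃ i, S i
  · obtain ⟨i, hi⟩ := Set.mem_iUnion.mp hx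
    rw [Set.indicator_of_mem hx]
    calc (1 : ℝ) = (S i).indicator (fun _ => (1 : ℝ)) x := (Set.indicator_of_mem hi (fun _ => (1 : ℝ))).symm
      _ ≤ ∑ j, (S j).indicator (fun _ => (1 : ℝ)) x := Finset.single_le_sum (f := fun j => (S j).indicator (fun _ => (1 : ℝ)) x)
        (fun j _ => Set.indicator_nonneg (fun _ _ => zero_le_one) x) (Finset.mem_univ i)
  · rw [Set.indicator_of_notMem hx]
    exact Finset.sum_nonneg fun j _ => Set.indicator_nonneg (fun _ _ => zero_le_one) x

/-- A weighted integrand cut to a measurable set stays integrable (`0 ≤ w`, `0 ≤ G`, `w·G` integrable). [folklore] -/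
theorem integrable_weight_indicator_mul {w G : α → ℝ} (s : Set α) (hs : MeasurableSet s) (hw : ∀ x, 0 ≤ w x) (hG : ∀ x, 0 ≤ G x)
    (hint : Integrable (fun x => w x * G x) μ) :
    Integrable (fun x => w x * s.indicator (fun _ => (1 : ℝ)) x * G x) μ := by
  have h1 : ∀ x, 0 ≤ s.indicator (fun _ => (1 : ℝ)) x := fun x => Set.indicator_nonneg (fun _ _ => zero_le_one) x
  have h2 : ∀ x, s.indicator (fun _ => (1 : ℝ)) x ≤ 1 := fun x => Set.indicator_le_self' (fun _ _ => zero_le_one) x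
  have hfg : (fun x => s.indicator (fun _ => (1 : ℝ)) x * (w x * G x)) = fun x => w x * s.indicator (fun _ => (1 : ℝ)) x * G x := funext fun x => by ring
  refine hint.mono' (hfg ▸ ((measurable_const.indicator hs).aestronglyMeasurable.mul hint.aestronglyMeasurable)) (ae_of_all _ fun x => ?_)
  rw [Real.norm_eq_abs, abs_of_nonneg (mul_nonneg (mul_nonneg (hw x) (h1 x)) (hG x))]
  calc w x * s.indicator (fun _ => (1 : ℝ)) x * G x ≤ w x * 1 * G x := mul_le_mul_of_nonneg_right (mul_le_mul_of_nonneg_left (h2 x) (hw x)) (hG x)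
    _ = w x * G x := by rw [mul_one]

/-- ★ **THE UNION BOUND** `∫ w·𝟙[⋃ᵢ Sᵢ]·G ≤ Σᵢ ∫ w·𝟙[Sᵢ]·G` (finite index type; `0 ≤ w`, `0 ≤ G`, `w·G` integrable; measure twin: lit ✓`T3CruxEstimates.real_not_plaqSmall_comp_le_sum`). [folklore] -/
theorem integral_indicator_iUnion_one_le_sum {w G : α → ℝ} (S : ι → Set α) (hS : ∀ i, MeasurableSet (S i))
    (hw : ∀ x, 0 ≤ w x) (hG : ∀ x, 0 ≤ G x) (hint : Integrable (fun x => w x * G x) μ) :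
    ∫ x, w x * (⋃ i, S i).indicator (fun _ => (1 : ℝ)) x * G x ∂μ ≤ ∑ i, ∫ x, w x * (S i).indicator (fun _ => (1 : ℝ)) x * G x ∂μ := by
  rw [← integral_finsetSum _ fun i _ => integrable_weight_indicator_mul μ _ (hS i) hw hG hint]
  refine integral_mono (integrable_weight_indicator_mul μ _ (MeasurableSet.iUnion hS) hw hG hint)
    (integrable_finsetSum _ fun i _ => integrable_weight_indicator_mul μ _ (hS i) hw hG hint) fun x => ?_
  have hsum : ∑ i, w x * (S i).indicator (fun _ => (1 : ℝ)) x * G x = w x * (∑ i, (S i).indicator (fun _ => (1 : ℝ)) x) * G x := by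
    rw [Finset.mul_sum, Finset.sum_mul]
  show w x * (⋃ i, S i).indicator (fun _ => (1 : ℝ)) x * G x ≤ ∑ i, w x * (S i).indicator (fun _ => (1 : ℝ)) x * G x
  rw [hsum]
  exact mul_le_mul_of_nonneg_right (mul_le_mul_of_nonneg_left (indicator_iUnion_one_le_sum S x) (hw x)) (hG x)

/-- **THE UNION BOUND UNDER A COVER**: if `W ⊆ ⋃ᵢ Sᵢ` then `∫ w·𝟙[W]·G ≤ Σᵢ ∫ w·𝟙[Sᵢ]·G`. [folklore] -/
theorem integral_indicator_le_sum_of_subset_iUnion {w G : α → ℝ} {W : Set α} (S : ι → Set α) (hW : MeasurableSet W) (hS : ∀ i, MeasurableSet (S i))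
    (hsub : W ⊆ ⋃ i, S i) (hw : ∀ x, 0 ≤ w x) (hG : ∀ x, 0 ≤ G x) (hint : Integrable (fun x => w x * G x) μ) :
    ∫ x, w x * W.indicator (fun _ => (1 : ℝ)) x * G x ∂μ ≤ ∑ i, ∫ x, w x * (S i).indicator (fun _ => (1 : ℝ)) x * G x ∂μ := by
  refine le_trans ?_ (integral_indicator_iUnion_one_le_sum μ S hS hw hG hint)
  refine integral_mono (integrable_weight_indicator_mul μ _ hW hw hG hint)
    (integrable_weight_indicator_mul μ _ (MeasurableSet.iUnion hS) hw hG hint) fun x => ?_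
  exact mul_le_mul_of_nonneg_right
    (mul_le_mul_of_nonneg_left (Set.indicator_le_indicator_of_subset hsub (fun _ => zero_le_one) x) (hw x)) (hG x)

omit [MeasurableSpace α] in
/-- The weight difference `χ − χ·𝟙[s](Ψ ·)` is the weight cut to the complement, `χ·𝟙[Ψ⁻¹ sᶜ]`. [folklore] -/
theorem sub_mul_indicator_eq {β : Type*} (Ψ : α → β) (s : Set β) (χ : α → ℝ) (x : α) :
    χ x - χ x * s.indicator (fun _ => (1 : ℝ)) (Ψ x) = χ x * (Ψ ⁻¹' sᶜ).indicator (fun _ => (1 : ℝ)) x := by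
  by_cases h : Ψ x ∈ s
  · have h' : x ∉ Ψ ⁻¹' sᶜ := fun hx => (Set.mem_preimage.mp hx) h
    rw [Set.indicator_of_mem h, Set.indicator_of_notMem h', mul_one, mul_zero, sub_self]
  · have h' : x ∈ Ψ ⁻¹' sᶜ := Set.mem_preimage.mpr h
    rw [Set.indicator_of_notMem h, Set.indicator_of_mem h', mul_zero, sub_zero, mul_one]

end Summit.QuantumFields.YangMills.Theorems.AnnulusSplit

/-! ## §3 (★2) in pin form: outside print's family some datum plaquette is large at the scaled threshold -/

namespace Summit.QuantumFields.YangMills.Theorems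

open MeasureTheory Literature.MathematicalPhysics.QuantumFieldTheory.Balaban1983to89
open Literature.MathematicalPhysics.QuantumFieldTheory.Balaban1983to89.T3ContinuumYM3Torus
open Literature.MathematicalPhysics.QuantumFieldTheory.Balaban1983to89.T3UnitScaleTilt (θBal)
open Literature.MathematicalPhysics.QuantumFieldTheory.Balaban1985CMP102 Literature.MathematicalPhysics.QuantumFieldTheory.Balaban1985CMP102.Setting
open Summit.QuantumFields.Balaban3D.Carriers
open Summit.QuantumFields.Balaban3D.Proofs.Primitives
open Summit.QuantumFields.Balaban3D.Proofs.TowerAC Summit.QuantumFields.Balaban3D.Proofs.StandardAC Summit.QuantumFields.Balaban3D.Proofs.InputsAC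
open scoped NNReal ENNReal

/-- The one-plaquette large-field set `{U | δ ≤ |U(∂p) − 1|}` is measurable. [folklore] -/
theorem AnnulusSplit.measurableSet_plaqLarge {P : Params} {j : ℕ} {G : Type*} [GaugeGroup G] [MeasurableSpace G] [RegularGaugeGroup G]
    (δ : ℝ) (p : Plaq P j) : MeasurableSet {U : GaugeField P j G | δ ≤ GaugeGroup.dist1 (GaugeField.plaqHol U p)} :=
  measurableSet_le measurable_const (RegularGaugeGroup.measurable_dist1.comp (Missing.measurable_plaqHol p))

variable {F : T3Family} {𝔠 : AlphaConsts F.L (suGroupModel 2).N} {γ : ℝ} {hγ : 0 < γ} {hγ1 : γ ≤ (min 𝔠.gamma0 1) ^ 2} {K : ℕ}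

namespace AlphaInputsT3AC.PkgCoreRows

variable (q : AlphaInputsT3AC.PkgCoreRows F 𝔠 γ hγ hγ1 K)

/-- ★ **(★2) IN PIN FORM** `(loPrintAC k)ᶜ ⊆ ⋃_{p′} {U | θBal(K−k)∕max(B₃,1) ≤ |U(∂p′) − 1|}`: contrapositive of ✓`intWindowT3_subset_loPrintAC` ([Balaban1985Variational] Thm 1 (8) = row r1
at the free radius, letter `θBal ≤ a₁`), the union step being lit ✓`T3CruxEstimates.setOf_not_plaqSmall_eq`. [cite: Balaban1985Variational, Thm 1 (8) p.279] -/
theorem compl_loPrintAC_subset_iUnion_plaqLarge (ha₁ : ∀ i, θBal F.L γ 𝔠.b₀ 𝔠.p₀ i ≤ q.a₁) (k : ℕ) (hk : k ≤ K) :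
    (PinnedStep.loPrintAC 𝔠.lane q.X k)ᶜ ⊆
      ⋃ p : Plaq (F.P K) k, {U : GaugeField (F.P K) k (Matrix.specialUnitaryGroup (Fin 2) ℂ) |
        θBal F.L γ 𝔠.b₀ 𝔠.p₀ (K - k) / max 𝔠.B₃ 1 ≤ GaugeGroup.dist1 (GaugeField.plaqHol U p)} := by
  intro U hU
  have hU' : ¬ PlaqSmall (θBal F.L γ 𝔠.b₀ 𝔠.p₀ (K - k) / max 𝔠.B₃ 1) U := fun h =>
    hU (q.intWindowT3_subset_loPrintAC ha₁ k hk (show U ∈ AlphaInputsT3AC.intWindowT3 F 𝔠 γ K k from h))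
  have hmem : U ∈ {V : GaugeField (F.P K) k (Matrix.specialUnitaryGroup (Fin 2) ℂ) | ¬ PlaqSmall (θBal F.L γ 𝔠.b₀ 𝔠.p₀ (K - k) / max 𝔠.B₃ 1) V} := hU'
  rw [T3CruxEstimates.setOf_not_plaqSmall_eq] at hmem
  exact hmem

/-! ## §4 ★ The (★3) skeleton: the pin gap is at most `log (1 + (Σ_{p′} a_{p′}) ∕ b)` -/

/-- ★★ **THE (★3) SKELETON — PLAIN PIN vs WEIGHTED PIN, the gap priced by annulus masses `a_{p′}` and the bulk value `b`.**  Any measure `μ`, measurable `Ψ` into the level-`k`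
fields (`Ψ = Φ(V, ·)` in the B0 pin), weight `χ ≥ 0` (`χB_k(triv′) ∘ Φ`), integrand `G ≥ 0`, `χ·G` integrable: IF `∫ χ·𝟙[θBal(K−k)∕max(B₃,1) ≤ |Ψ(·)(∂p′) − 1|]·G ≤ a_{p′}` for every
level-`k` plaquette `p′` ((★1)-scaled ∘ [Balaban1985UV3] (67)–(71)) and `0 < b ≤ ∫ χ·𝟙[loPrintAC k](Ψ ·)·G` ((58)), THEN `log ∫ χ·G ≤ log ∫ χ·𝟙[loPrintAC k](Ψ ·)·G + log (1 + (Σ_{p′} a_{p′})∕b)`.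
[cite: Balaban1985UV3, (67)–(71) p.273] -/
theorem log_gap_le_of_annulus (ha₁ : ∀ i, θBal F.L γ 𝔠.b₀ 𝔠.p₀ i ≤ q.a₁) (k : ℕ) (hk : k ≤ K)
    {β : Type*} [MeasurableSpace β] (μ : Measure β)
    (Ψ : β → GaugeField (F.P K) k (Matrix.specialUnitaryGroup (Fin 2) ℂ)) (hΨ : Measurable Ψ)
    {χ G : β → ℝ} (hχ : ∀ x, 0 ≤ χ x) (hG : ∀ x, 0 ≤ G x) (hint : Integrable (fun x => χ x * G x) μ)
    (a : Plaq (F.P K) k → ℝ)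
    (ha : ∀ p, ∫ x, χ x * {U : GaugeField (F.P K) k (Matrix.specialUnitaryGroup (Fin 2) ℂ) |
        θBal F.L γ 𝔠.b₀ 𝔠.p₀ (K - k) / max 𝔠.B₃ 1 ≤ GaugeGroup.dist1 (GaugeField.plaqHol U p)}.indicator (fun _ => (1 : ℝ)) (Ψ x) * G x ∂μ ≤ a p)
    {b : ℝ} (hb : 0 < b) (hb₁ : b ≤ ∫ x, χ x * (PinnedStep.loPrintAC 𝔠.lane q.X k).indicator (fun _ => (1 : ℝ)) (Ψ x) * G x ∂μ) :
    Real.log (∫ x, χ x * G x ∂μ) ≤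
      Real.log (∫ x, χ x * (PinnedStep.loPrintAC 𝔠.lane q.X k).indicator (fun _ => (1 : ℝ)) (Ψ x) * G x ∂μ) + Real.log (1 + (∑ p, a p) / b) := by
  have hlom : MeasurableSet (PinnedStep.loPrintAC 𝔠.lane q.X k) := PinnedStep.measurableSet_loPrintAC 𝔠.lane q.X k (q.measurable_UkH k hk _)
  set lo := PinnedStep.loPrintAC 𝔠.lane q.X k with hlo
  set A : Plaq (F.P K) k → Set (GaugeField (F.P K) k (Matrix.specialUnitaryGroup (Fin 2) ℂ)) := fun p =>
    {U | θBal F.L γ 𝔠.b₀ 𝔠.p₀ (K - k) / max 𝔠.B₃ 1 ≤ GaugeGroup.dist1 (GaugeField.plaqHol U p)} with hA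
  have hAm : ∀ p, MeasurableSet (A p) := fun p => AnnulusSplit.measurableSet_plaqLarge _ p
  have h2 : ∀ x, lo.indicator (fun _ => (1 : ℝ)) (Ψ x) ≤ 1 := fun x => Set.indicator_le_self' (fun _ _ => zero_le_one) _
  have hint₁ : Integrable (fun x => χ x * lo.indicator (fun _ => (1 : ℝ)) (Ψ x) * G x) μ := by
    refine (AnnulusSplit.integrable_weight_indicator_mul μ (Ψ ⁻¹' lo) (hΨ hlom) hχ hG hint).congr (ae_of_all _ fun x => ?_)
    exact congrArg (fun t : ℝ => χ x * t * G x) (Set.indicator_comp_right (s := lo) Ψ (g := fun _ => (1 : ℝ)) (x := x))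
  have hdiff : ∫ x, (χ x - χ x * lo.indicator (fun _ => (1 : ℝ)) (Ψ x)) * G x ∂μ =
      ∫ x, χ x * (Ψ ⁻¹' loᶜ).indicator (fun _ => (1 : ℝ)) x * G x ∂μ :=
    integral_congr_ae (ae_of_all _ fun x => congrArg (fun t : ℝ => t * G x) (AnnulusSplit.sub_mul_indicator_eq Ψ lo χ x))
  have hsub : Ψ ⁻¹' loᶜ ⊆ ⋃ p, Ψ ⁻¹' (A p) := fun x hx => by
    obtain ⟨p, hp⟩ := Set.mem_iUnion.mp (q.compl_loPrintAC_subset_iUnion_plaqLarge ha₁ k hk (Set.mem_preimage.mp hx))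
    exact Set.mem_iUnion.mpr ⟨p, Set.mem_preimage.mpr hp⟩
  have hAbound : ∫ x, (χ x - χ x * lo.indicator (fun _ => (1 : ℝ)) (Ψ x)) * G x ∂μ ≤ ∑ p, a p := by
    rw [hdiff]
    refine (AnnulusSplit.integral_indicator_le_sum_of_subset_iUnion μ (fun p => Ψ ⁻¹' (A p)) (hΨ hlom.compl)
      (fun p => hΨ (hAm p)) hsub hχ hG hint).trans (Finset.sum_le_sum fun p _ => ?_)
    exact le_of_eq_of_le (integral_congr_ae (ae_of_all _ fun x =>
      congrArg (fun t : ℝ => χ x * t * G x) (Set.indicator_comp_right (s := A p) Ψ (g := fun _ => (1 : ℝ)) (x := x)))) (ha p)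
  exact AnnulusSplit.log_integral_le_log_integral_add_log μ hG
    (fun x => (mul_le_mul_of_nonneg_left (h2 x) (hχ x)).trans_eq (mul_one _)) hint hint₁ hAbound hb hb₁

end AlphaInputsT3AC.PkgCoreRows

end Summit.QuantumFields.YangMills.Theorems

end
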